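import Summits.HubbardSuperconductivity.Statement
import Summits.HubbardSuperconductivity.HubbardSuperconductivity.Theorems.FunctionFieldCertificateAssemblyFejerGlue
import HarnessLib

/-!
# Route `FunctionFieldCertificate` — uniform pair order from the two halves; the target `CertifiedSectorLRO` from the cruxes

Companion of `Theorems/FunctionFieldCertificateAssemblyFejerGlue.lean` (the Fejér glue) for the
TARGET item `CertifiedSectorLRO` (stmt-HubbardSuperconductivity-7330, rank 0) of route
`HubbardSuperconductivity/FunctionFieldCertificate`. The route's deciding theorem consumes the two
ranked halves `MesoscopicPairOrder` (stmt-7331) and `WindowInfraredBound` (stmt-1089) through the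
`Assembly`; the target `X = CertifiedSectorLRO` (the per-`L` SOS + KKT + `[H,R]` + sector-term
certificate) is reached only through the support `CertificateCompleteness` (stmt-7334) — the
route-review's "shape inconsistency (3)". This file supplies the missing glue, in two steps:

* `functionFieldCertificate_uniformPairOrder_of_halves` — the CONTENT of the Assembly before any
  `liminf` bookkeeping, stated as the uniform every-ground-state `d`-wave pair order that is
  LITERALLY the antecedent of `CertificateCompleteness`: from the two halves, at the `(U, δ)` of
  `MesoscopicPairOrder` there are `a = m/2 > 0` and `L₀` with `a ≤ Re⟨ψ, Δ_d†Δ_d ψ⟩/L⁴` for every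
  even `L ≥ L₀` and every normalised `(N_L, S^z = 0)`-sector ground state `ψ` of `hubbardTorus 2 L 1 U`
  (Fejér glue `FunctionFieldCertificateAssembly.fejer_glue` + the constants
  `ε := min ε₀ (m/(4(C+1)))`, `R ≥ ⌈8π²C_d²/(mε²)⌉₊ + 1`, `L ≥ max (max L₁ L₂) (2R)`);
* `functionFieldCertificate_certifiedSectorLRO_of_cruxes` — TARGET REACHABILITY:
  `MesoscopicPairOrder → WindowInfraredBound → CertificateCompleteness → CertifiedSectorLRO`
  (modus ponens on the previous theorem).

DESIGN: as for the Assembly modules, the types are spelled out STRUCTURALLY (verbatim bodies of the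
four route decls, Theses/FunctionFieldCertificate.lean) and the route's Theses module is NOT
imported, so that the route file may import this module without a cycle; each type is the
corresponding implication between route decls by `δ`-unfolding alone (checked in a scratch file
importing the Theses module, rc 0). Nothing here closes an item: the target stays conditional on the
two open cruxes and on stmt-7334. No definition is introduced.

Sources: Kennedy–Lieb–Shastry, PRL 61 (1988) 2582 [KLS1988PRL]; Scalapino, Phys. Rep. 250 (1995)
329, §2 eq. (2.4) [Scalapino1995]; Fawzi–Fawzi–Scalet (2024) (certified ground-state bounds, the
semantic interface of `CertifiedSectorLRO`) [FawziFawziScalet2024].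
-/

noncomputable section

-- the summit namespace `Summit.HubbardSuperconductivity.HubbardSuperconductivity.…` repeats the problem name by design (D-0017)
set_option linter.dupNamespace false

namespace Summit.HubbardSuperconductivity.HubbardSuperconductivity.Theorems

open Matrix Finset Filter
open Literature.Probability.LatticeModels Literature.MathematicalPhysics.QuantumLattice
open scoped ComplexConjugate ComplexOrder

open FunctionFieldCertificateAssembly in
/-- **Uniform every-ground-state `d`-wave pair order from the two halves of route
`FunctionFieldCertificate`**: (`MesoscopicPairOrder`, verbatim) → (`WindowInfraredBound`, verbatim) →
(the antecedent of `CertificateCompleteness`, verbatim): at the `(U, δ)` of the first hypothesis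
there are `a > 0` and `L₀` such that `a ≤ Re⟨ψ, Δ_d†Δ_d ψ⟩/L⁴` for every even `L ≥ L₀` and every
normalised sector ground state `ψ`. Proof: `(C, ε₀, L₁)` from the window bound at `(U, δ)`;
`ε := min ε₀ (m/(4(C+1)))` (so `Cε ≤ m/4`); a scale `R ≥ ⌈8π²C_d²/(mε²)⌉₊ + 1` from mesoscopic pair
order (so `2π²C_d²/(R²ε²) ≤ m/4`) with threshold `L₂`; for even `L ≥ max (max L₁ L₂) (2R)` the
fixed-side glue `fejer_glue` gives `T/(R²L²) - W/L² - 2π²C_d²/(R²ε²) ≤ Re⟨ψ, Δ_d†Δ_d ψ⟩/L⁴` with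
`T/(R²L²) ≥ m` and `W/L² ≤ Cε` (the `let D` of the window bound is `pairFieldAt`, its summand
`pairStructureFactor`, definitionally; strict window inside the closed one), whence `a := m/2`.
Kennedy–Lieb–Shastry, PRL 61 (1988) 2582; Scalapino (1995) §2 eq. (2.4). [folklore] -/
theorem functionFieldCertificate_uniformPairOrder_of_halves :
    (∃ U : ℝ, 0 < U ∧ ∃ δ ∈ Set.Ioo (0:ℝ) (1 / 2), ∃ m : ℝ, 0 < m ∧ ∀ R₀ : ℕ, ∃ R : ℕ, R₀ ≤ R ∧ ∃ L₀ : ℕ, ∀ (L : ℕ) [NeZero L], L₀ ≤ L → Even L → ∀ ψ : Literature.MathematicalPhysics.QuantumLattice.Fock (Literature.MathematicalPhysics.QuantumLattice.Orb (Literature.MathematicalPhysics.QuantumLattice.FermionTorus 2 L)), star ψ ⬝ᵥ ψ = 1 → Literature.MathematicalPhysics.QuantumLattice.IsGroundStateInSector (Literature.MathematicalPhysics.QuantumLattice.hubbardTorus 2 L 1 U) (2 * ⌊(1 - δ) * (L : ℝ) ^ 2 / 2⌋₊) 0 ψ → m * (R : ℝ) ^ 2 ≤ (∑ x : Fin 2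 → ZMod L, ∑ y : Fin 2 → ZMod L, (∏ i : Fin 2, max 0 (1 - |(((y i - x i).valMinAbs : ℤ) : ℝ)| / (R : ℝ))) * (star (Matrix.mulVec (Literature.MathematicalPhysics.QuantumLattice.localPair Literature.MathematicalPhysics.QuantumLattice.dWaveFormFactor L x) ψ) ⬝ᵥ Matrix.mulVec (Literature.MathematicalPhysics.QuantumLattice.localPair Literature.MathematicalPhysics.QuantumLattice.dWaveFormFactor L y) ψ).re) / (L : ℝ) ^ 2) →
      (∀ U : ℝ, 0 < U → ∀ δ ∈ Set.Ioo (0:ℝ) (1 / 2), ∃ C ε₀ : ℝ, 0 ≤ C ∧ 0 < ε₀ ∧ ∃ L₀ : ℕ, ∀ ε ∈ Set.Ioc (0:ℝ) ε₀, ∀ (L : ℕ) [NeZero L], L₀ ≤ L → Even L → let D : (Fin 2 → ZMod L) → Matrix (Finset (Literature.MathematicalPhysics.QuantumLattice.Orb (Literature.MathematicalPhysics.QuantumLattice.FermionTorus 2 L))) (Finset (Literature.MathematicalPhysics.QuantumLattice.Orb (Literature.MathematicalPhysics.QuantumLattice.FermionTorus 2 L))) ℂ := fun m => ∑ x : Fin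 2 → ZMod L, Complex.exp (-(2 * Real.pi * Complex.I * (((∑ i : Fin 2, m i * x i).val : ℕ) : ℂ) / (L : ℂ))) • Literature.MathematicalPhysics.QuantumLattice.localPair Literature.MathematicalPhysics.QuantumLattice.dWaveFormFactor L x; ∀ ψ : Literature.MathematicalPhysics.QuantumLattice.Fock (Literature.MathematicalPhysics.QuantumLattice.Orb (Literature.MathematicalPhysics.QuantumLattice.FermionTorus 2 L)), star ψ ⬝ᵥ ψ = 1 → Literature.MathematicalPhysics.QuantumLattice.IsGroundStateInSector (Literature.MathematicalPhysics.QuantumLattice.hubbardTorus 2 L 1 U) (2 * ⌊(1 - δ) * (L : ℝ) ^ 2 / 2⌋₊) 0 ψ → (∑ m : Fin 2 → ZMod L, if m ≠ 0 ∧ (2 * Real.pi / (L : ℝ)) ^ 2 * (∑ i : Fin 2, (((m i).valMinAbs : ℤ) : ℝ) ^ 2) ≤ ε ^ 2 then (star (Matrix.mulVec (D m) ψ) ⬝ᵥ Matrix.mulVec (D m) ψ).re / (L : ℝ) ^ 2 else 0) ≤ C * ε * (L : ℝ) ^ 2) →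
        (∃ U : ℝ, 0 < U ∧ ∃ δ ∈ Set.Ioo (0:ℝ) (1 / 2), ∃ a : ℝ, 0 < a ∧ ∃ L₀ : ℕ, ∀ (L : ℕ) [NeZero L], L₀ ≤ L → Even L → ∀ ψ : Literature.MathematicalPhysics.QuantumLattice.Fock (Literature.MathematicalPhysics.QuantumLattice.Orb (Literature.MathematicalPhysics.QuantumLattice.FermionTorus 2 L)), star ψ ⬝ᵥ ψ = 1 → Literature.MathematicalPhysics.QuantumLattice.IsGroundStateInSector (Literature.MathematicalPhysics.QuantumLattice.hubbardTorus 2 L 1 U) (2 * ⌊(1 - δ) * (L : ℝ) ^ 2 / 2⌋₊) 0 ψ → a ≤ (star ψ ⬝ᵥ Matrix.mulVec (Matrix.conjTranspose (Literature.MathematicalPhysics.QuantumLattice.pairField Literature.MathematicalPhysics.QuantumLattice.dWaveFormFactor L) * Literature.MathematicalPhysics.QuantumLattice.pairField Literature.MathematicalPhysics.QuantumLattice.dWaveFormFactor L) ψ).re / (L : ℝ) ^ 4) := by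
  intro hMeso hWIB
  obtain ⟨U, hU, δ, hδ, m, hm, hMesoR⟩ := hMeso
  obtain ⟨C, ε₀, hC, hε₀, L₁, hW⟩ := hWIB U hU δ hδ
  -- the crude local-pair constant of the `d`-wave form factor
  set Cd : ℝ := ∑ e ∈ insert (0 : Site 2) unitSteps,
    ‖((dWaveFormFactor e / Real.sqrt 2 : ℝ) : ℂ)‖ * 2 with hCd
  -- the window `ε`
  have hC1 : 0 < C + 1 := by linarith
  set ε : ℝ := min ε₀ (m / (4 * (C + 1))) with hε_def
  have hε : 0 < ε := lt_min hε₀ (by positivity)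
  have hεε₀ : ε ∈ Set.Ioc (0:ℝ) ε₀ := ⟨hε, min_le_left _ _⟩
  have hCε : C * ε ≤ m / 4 := by
    have h1 : ε ≤ m / (4 * (C + 1)) := min_le_right _ _
    have h2 : C * ε ≤ C * (m / (4 * (C + 1))) := mul_le_mul_of_nonneg_left h1 hC
    have h3 : C * (m / (4 * (C + 1))) = m / 4 * (C / (C + 1)) := by
      field_simp
    have h4 : C / (C + 1) ≤ 1 := (div_le_one hC1).2 (by linarith)
    have h5 : m / 4 * (C / (C + 1)) ≤ m / 4 * 1 :=
      mul_le_mul_of_nonneg_left h4 (by positivity)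
    linarith
  -- the block scale `R`
  set K : ℝ := 8 * Real.pi ^ 2 * Cd ^ 2 / (m * ε ^ 2) with hK
  obtain ⟨R, hR₀R, L₂, hMesoL⟩ := hMesoR (⌈K⌉₊ + 1)
  have hR1 : 1 ≤ R := le_trans (Nat.le_add_left 1 _) hR₀R
  have hRpos : 0 < R := hR1
  have hR1ℝ : (1 : ℝ) ≤ R := by exact_mod_cast hR1
  have hKR : K ≤ R := by
    have h1 : K ≤ ⌈K⌉₊ := Nat.le_ceil K
    have h2 : ((⌈K⌉₊ + 1 : ℕ) : ℝ) ≤ R := by exact_mod_cast hR₀R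
    push_cast at h2
    linarith
  have htail : 2 * Real.pi ^ 2 * Cd ^ 2 / ((R : ℝ) ^ 2 * ε ^ 2) ≤ m / 4 := by
    rw [div_le_iff₀ (by positivity)]
    have h1 : 8 * Real.pi ^ 2 * Cd ^ 2 ≤ R * (m * ε ^ 2) := by
      have h := hKR
      rw [hK, div_le_iff₀ (by positivity)] at h
      exact h
    have h2 : (R : ℝ) * (m * ε ^ 2) ≤ (R : ℝ) ^ 2 * (m * ε ^ 2) := by
      apply mul_le_mul_of_nonneg_right _ (by positivity)
      nlinarith
    nlinarith [h1, h2]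
  -- witnesses `(U, δ, a := m/2)`; thresholds `L ≥ max (max L₁ L₂) (2R)`, `L` even
  refine ⟨U, hU, δ, hδ, m / 2, by positivity, max (max L₁ L₂) (2 * R), ?_⟩
  intro L _ hL hEven φ hφ hGS
  have hL₁ : L₁ ≤ L := le_trans (le_trans (le_max_left _ _) (le_max_left _ _)) hL
  have hL₂ : L₂ ≤ L := le_trans (le_trans (le_max_right _ _) (le_max_left _ _)) hL
  have h2R : 2 * R ≤ L := le_trans (le_max_right _ _) hL
  have hLpos : (0 : ℝ) < L := Nat.cast_pos.2 (Nat.pos_of_ne_zero (NeZero.ne L))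
  -- (i) the fixed-side glue
  have hglue := fejer_glue dWaveFormFactor L R hRpos h2R ε hε φ hφ
  -- (ii) mesoscopic pair order at scale `R`: `m ≤ T/(R²L²)`
  have hmeso : m * (R : ℝ) ^ 2 ≤ (∑ x : TorusSite 2 L, ∑ y : TorusSite 2 L,
      (∏ i : Fin 2, max 0 (1 - |(((y i - x i).valMinAbs : ℤ) : ℝ)| / (R : ℝ))) *
        (star (localPair dWaveFormFactor L x *ᵥ φ) ⬝ᵥ (localPair dWaveFormFactor L y *ᵥ φ)).re) /
          (L : ℝ) ^ 2 := hMesoL L hL₂ hEven φ hφ hGS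
  have hmeso' : m ≤ (∑ x : TorusSite 2 L, ∑ y : TorusSite 2 L,
      (∏ i : Fin 2, max 0 (1 - |(((y i - x i).valMinAbs : ℤ) : ℝ)| / (R : ℝ))) *
        (star (localPair dWaveFormFactor L x *ᵥ φ) ⬝ᵥ (localPair dWaveFormFactor L y *ᵥ φ)).re) /
          ((R : ℝ) ^ 2 * (L : ℝ) ^ 2) := by
    rw [le_div_iff₀ (by positivity)] at hmeso ⊢
    calc m * ((R : ℝ) ^ 2 * (L : ℝ) ^ 2) = m * (R : ℝ) ^ 2 * (L : ℝ) ^ 2 := by ring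
      _ ≤ _ := hmeso
  -- (iii) the window infrared bound at `ε`: `W/L² ≤ Cε` (`let D` = `pairFieldAt`, definitionally)
  have hwin : (∑ k : TorusSite 2 L, if k ≠ 0 ∧ momentumNormSq L k ≤ ε ^ 2 then
      pairStructureFactor dWaveFormFactor L φ k else 0) ≤ C * ε * (L : ℝ) ^ 2 :=
    hW ε hεε₀ L hL₁ hEven φ hφ hGS
  have hsub : (Finset.univ.filter fun k : TorusSite 2 L => k ≠ 0 ∧ momentumNormSq L k < ε ^ 2) ⊆
      (Finset.univ.filter fun k : TorusSite 2 L => k ≠ 0 ∧ momentumNormSq L k ≤ ε ^ 2) := by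
    intro k
    simp only [Finset.mem_filter, Finset.mem_univ, true_and]
    exact fun hk => ⟨hk.1, hk.2.le⟩
  have hle := Finset.sum_le_sum_of_subset_of_nonneg hsub
    (fun k _ _ => pairStructureFactor_nonneg dWaveFormFactor L φ k)
  replace hle := hle.trans_eq (Finset.sum_filter _ _)
  have hwin' : (∑ k ∈ (Finset.univ.filter fun k : TorusSite 2 L => k ≠ 0 ∧ momentumNormSq L k < ε ^ 2),
      pairStructureFactor dWaveFormFactor L φ k) / (L : ℝ) ^ 2 ≤ m / 4 := by
    rw [div_le_iff₀ (by positivity)]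
    calc _ ≤ _ := hle
      _ ≤ C * ε * (L : ℝ) ^ 2 := hwin
      _ ≤ m / 4 * (L : ℝ) ^ 2 := mul_le_mul_of_nonneg_right hCε (by positivity)
  -- (iv) combine: `Re⟨φ, Δ_d†Δ_d φ⟩/L⁴ ≥ m - m/4 - m/4` (`expect` unfolded to the route's spelling)
  have hglue' : (∑ x : TorusSite 2 L, ∑ y : TorusSite 2 L,
      (∏ i : Fin 2, max 0 (1 - |(((y i - x i).valMinAbs : ℤ) : ℝ)| / (R : ℝ))) *
        (star (localPair dWaveFormFactor L x *ᵥ φ) ⬝ᵥ (localPair dWaveFormFactor L y *ᵥ φ)).re) /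
          ((R : ℝ) ^ 2 * (L : ℝ) ^ 2) -
      (∑ k ∈ (Finset.univ.filter fun k : TorusSite 2 L => k ≠ 0 ∧ momentumNormSq L k < ε ^ 2),
          pairStructureFactor dWaveFormFactor L φ k) / (L : ℝ) ^ 2 -
      2 * Real.pi ^ 2 * Cd ^ 2 / ((R : ℝ) ^ 2 * ε ^ 2) ≤
      (star φ ⬝ᵥ ((pairField dWaveFormFactor L)ᴴ * pairField dWaveFormFactor L) *ᵥ φ).re /
        (L : ℝ) ^ 4 := hglue
  linarith [hglue', hmeso', hwin', htail]

/-- **Target reachability for route `FunctionFieldCertificate`** (item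
`stmt-HubbardSuperconductivity-7330`, `CertifiedSectorLRO`, from the cruxes):
(`MesoscopicPairOrder`) → (`WindowInfraredBound`) → (`CertificateCompleteness`) →
(`CertifiedSectorLRO`), all four bodies verbatim, so that this type is the implication between the
route decls by `δ`-unfolding. Proof: `CertificateCompleteness` applied to
`functionFieldCertificate_uniformPairOrder_of_halves`. [folklore] -/
theorem functionFieldCertificate_certifiedSectorLRO_of_cruxes :
    (∃ U : ℝ, 0 < U ∧ ∃ δ ∈ Set.Ioo (0:ℝ) (1 / 2), ∃ m : ℝ, 0 < m ∧ ∀ R₀ : ℕ, ∃ R : ℕ, R₀ ≤ R ∧ ∃ L₀ : ℕ, ∀ (L : ℕ) [NeZero L], L₀ ≤ L → Even L → ∀ ψ : Literature.MathematicalPhysics.QuantumLattice.Fock (Literature.MathematicalPhysics.QuantumLattice.Orb (Literature.MathematicalPhysics.QuantumLattice.FermionTorus 2 L)), star ψ ⬝ᵥ ψ = 1 → Literature.MathematicalPhysics.QuantumLattice.IsGroundStateInSector (Literature.MathematicalPhysics.QuantumLattice.hubbardTorus 2 L 1 U) (2 * ⌊(1 - δ) * (L : ℝ) ^ 2 / 2⌋₊)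 0 ψ → m * (R : ℝ) ^ 2 ≤ (∑ x : Fin 2 → ZMod L, ∑ y : Fin 2 → ZMod L, (∏ i : Fin 2, max 0 (1 - |(((y i - x i).valMinAbs : ℤ) : ℝ)| / (R : ℝ))) * (star (Matrix.mulVec (Literature.MathematicalPhysics.QuantumLattice.localPair Literature.MathematicalPhysics.QuantumLattice.dWaveFormFactor L x) ψ) ⬝ᵥ Matrix.mulVec (Literature.MathematicalPhysics.QuantumLattice.localPair Literature.MathematicalPhysics.QuantumLattice.dWaveFormFactor L y) ψ).re) / (L : ℝ) ^ 2) →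
      (∀ U : ℝ, 0 < U → ∀ δ ∈ Set.Ioo (0:ℝ) (1 / 2), ∃ C ε₀ : ℝ, 0 ≤ C ∧ 0 < ε₀ ∧ ∃ L₀ : ℕ, ∀ ε ∈ Set.Ioc (0:ℝ) ε₀, ∀ (L : ℕ) [NeZero L], L₀ ≤ L → Even L → let D : (Fin 2 → ZMod L) → Matrix (Finset (Literature.MathematicalPhysics.QuantumLattice.Orb (Literature.MathematicalPhysics.QuantumLattice.FermionTorus 2 L))) (Finset (Literature.MathematicalPhysics.QuantumLattice.Orb (Literature.MathematicalPhysics.QuantumLattice.FermionTorus 2 L))) ℂ := fun m => ∑ x : Fin 2 → ZMod L, Complex.exp (-(2 * Real.pi * Complex.I * (((∑ i : Fin 2, m i * x i).val : ℕ) : ℂ) / (L : ℂ))) • Literature.MathematicalPhysics.QuantumLattice.localPair Literature.MathematicalPhysics.QuantumLattice.dWaveFormFactor L x; ∀ ψ : Literature.MathematicalPhysics.QuantumLattice.Fock (Literature.MathematicalPhysics.QuantumLattice.Orb (Literature.MathematicalPhysics.QuantumLattice.FermionTorus 2 L)), star ψ ⬝ᵥ ψ = 1 → Literature.MathematicalPhysics.QuantumLattice.IsGroundStateInSector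 (Literature.MathematicalPhysics.QuantumLattice.hubbardTorus 2 L 1 U) (2 * ⌊(1 - δ) * (L : ℝ) ^ 2 / 2⌋₊) 0 ψ → (∑ m : Fin 2 → ZMod L, if m ≠ 0 ∧ (2 * Real.pi / (L : ℝ)) ^ 2 * (∑ i : Fin 2, (((m i).valMinAbs : ℤ) : ℝ) ^ 2) ≤ ε ^ 2 then (star (Matrix.mulVec (D m) ψ) ⬝ᵥ Matrix.mulVec (D m) ψ).re / (L : ℝ) ^ 2 else 0) ≤ C * ε * (L : ℝ) ^ 2) →
        ((∃ U : ℝ, 0 < U ∧ ∃ δ ∈ Set.Ioo (0:ℝ) (1 / 2), ∃ a : ℝ, 0 < a ∧ ∃ L₀ : ℕ, ∀ (L : ℕ) [NeZero L], L₀ ≤ L → Even L → ∀ ψ : Literature.MathematicalPhysics.QuantumLattice.Fock (Literature.MathematicalPhysics.QuantumLattice.Orb (Literature.MathematicalPhysics.QuantumLattice.FermionTorus 2 L)), star ψ ⬝ᵥ ψ = 1 → Literature.MathematicalPhysics.QuantumLattice.IsGroundStateInSector (Literature.MathematicalPhysics.QuantumLattice.hubbardTorus 2 L 1 U) (2 *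 ⌊(1 - δ) * (L : ℝ) ^ 2 / 2⌋₊) 0 ψ → a ≤ (star ψ ⬝ᵥ Matrix.mulVec (Matrix.conjTranspose (Literature.MathematicalPhysics.QuantumLattice.pairField Literature.MathematicalPhysics.QuantumLattice.dWaveFormFactor L) * Literature.MathematicalPhysics.QuantumLattice.pairField Literature.MathematicalPhysics.QuantumLattice.dWaveFormFactor L) ψ).re / (L : ℝ) ^ 4) → (∃ U : ℝ, 0 < U ∧ ∃ δ ∈ Set.Ioo (0:ℝ) (1 / 2), ∃ a C : ℝ, 0 < a ∧ ∃ L₀ : ℕ, ∀ (L : ℕ) [NeZero L], L₀ ≤ L → Even L → ∃ (n m : ℕ) (O : Fin n → Matrix (Finset (Literature.MathematicalPhysics.QuantumLattice.Orb (Literature.MathematicalPhysics.QuantumLattice.FermionTorus 2 L))) (Finset (Literature.MathematicalPhysics.QuantumLattice.Orb (Literature.MathematicalPhysics.QuantumLattice.FermionTorus 2 L))) ℂ) (Q : Fin m → Matrix (Finset (Literature.MathematicalPhysics.QuantumLattice.Orb (Literature.MathematicalPhysics.QuantumLattice.FermionTorus 2 L))) (Finset (Literature.MathematicalPhysics.QuantumLattice.Orb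 (Literature.MathematicalPhysics.QuantumLattice.FermionTorus 2 L))) ℂ) (R T : Matrix (Finset (Literature.MathematicalPhysics.QuantumLattice.Orb (Literature.MathematicalPhysics.QuantumLattice.FermionTorus 2 L))) (Finset (Literature.MathematicalPhysics.QuantumLattice.Orb (Literature.MathematicalPhysics.QuantumLattice.FermionTorus 2 L))) ℂ), (∀ (i : Fin m) (ψ : Literature.MathematicalPhysics.QuantumLattice.Fock (Literature.MathematicalPhysics.QuantumLattice.Orb (Literature.MathematicalPhysics.QuantumLattice.FermionTorus 2 L))), ψ ∈ Literature.MathematicalPhysics.QuantumLattice.szSector (2 * ⌊(1 - δ) * (L : ℝ) ^ 2 / 2⌋₊) 0 → Matrix.mulVec (Q i) ψ ∈ Literature.MathematicalPhysics.QuantumLattice.szSector (2 * ⌊(1 - δ) * (L : ℝ) ^ 2 / 2⌋₊) 0) ∧ (∀ ψ : Literature.MathematicalPhysics.QuantumLattice.Fock (Literature.MathematicalPhysics.QuantumLattice.Orb (Literature.MathematicalPhysics.QuantumLattice.FermionTorus 2 L)), ψ ∈ Literature.MathematicalPhysics.QuantumLattice.szSector (2 * ⌊(1 - δ) * (L : ℝ)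 ^ 2 / 2⌋₊) 0 → star ψ ⬝ᵥ Matrix.mulVec T ψ = 0) ∧ (1 / (L : ℂ) ^ 4) • (Matrix.conjTranspose (Literature.MathematicalPhysics.QuantumLattice.pairField Literature.MathematicalPhysics.QuantumLattice.dWaveFormFactor L) * Literature.MathematicalPhysics.QuantumLattice.pairField Literature.MathematicalPhysics.QuantumLattice.dWaveFormFactor L) - ((a - C / (L : ℝ) : ℝ) : ℂ) • (1 : Matrix (Finset (Literature.MathematicalPhysics.QuantumLattice.Orb (Literature.MathematicalPhysics.QuantumLattice.FermionTorus 2 L))) (Finset (Literature.MathematicalPhysics.QuantumLattice.Orb (Literature.MathematicalPhysics.QuantumLattice.FermionTorus 2 L))) ℂ) = ∑ i : Fin n, Matrix.conjTranspose (O i) * O i + ∑ i : Fin m, Matrix.conjTranspose (Q i) * (Literature.MathematicalPhysics.QuantumLattice.hubbardTorus 2 L 1 U * Q i - Q i * Literature.MathematicalPhysics.QuantumLattice.hubbardTorus 2 L 1 U) + (Literature.MathematicalPhysics.QuantumLattice.hubbardTorus 2 L 1 U * R - R * Literature.MathematicalPhysics.QuantumLattice.hubbardTorus 2 L 1 U)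 + T)) →
          (∃ U : ℝ, 0 < U ∧ ∃ δ ∈ Set.Ioo (0:ℝ) (1 / 2), ∃ a C : ℝ, 0 < a ∧ ∃ L₀ : ℕ, ∀ (L : ℕ) [NeZero L], L₀ ≤ L → Even L → ∃ (n m : ℕ) (O : Fin n → Matrix (Finset (Literature.MathematicalPhysics.QuantumLattice.Orb (Literature.MathematicalPhysics.QuantumLattice.FermionTorus 2 L))) (Finset (Literature.MathematicalPhysics.QuantumLattice.Orb (Literature.MathematicalPhysics.QuantumLattice.FermionTorus 2 L))) ℂ) (Q : Fin m → Matrix (Finset (Literature.MathematicalPhysics.QuantumLattice.Orb (Literature.MathematicalPhysics.QuantumLattice.FermionTorus 2 L))) (Finset (Literature.MathematicalPhysics.QuantumLattice.Orb (Literature.MathematicalPhysics.QuantumLattice.FermionTorus 2 L))) ℂ) (R T : Matrix (Finset (Literature.MathematicalPhysics.QuantumLattice.Orb (Literature.MathematicalPhysics.QuantumLattice.FermionTorus 2 L))) (Finset (Literature.MathematicalPhysics.QuantumLattice.Orb (Literature.MathematicalPhysics.QuantumLattice.FermionTorus 2 L))) ℂ), (∀ (i : Fin m) (ψ : Literature.MathematicalPhysics.QuantumLattice.Fock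 (Literature.MathematicalPhysics.QuantumLattice.Orb (Literature.MathematicalPhysics.QuantumLattice.FermionTorus 2 L))), ψ ∈ Literature.MathematicalPhysics.QuantumLattice.szSector (2 * ⌊(1 - δ) * (L : ℝ) ^ 2 / 2⌋₊) 0 → Matrix.mulVec (Q i) ψ ∈ Literature.MathematicalPhysics.QuantumLattice.szSector (2 * ⌊(1 - δ) * (L : ℝ) ^ 2 / 2⌋₊) 0) ∧ (∀ ψ : Literature.MathematicalPhysics.QuantumLattice.Fock (Literature.MathematicalPhysics.QuantumLattice.Orb (Literature.MathematicalPhysics.QuantumLattice.FermionTorus 2 L)), ψ ∈ Literature.MathematicalPhysics.QuantumLattice.szSector (2 * ⌊(1 - δ) * (L : ℝ) ^ 2 / 2⌋₊) 0 → star ψ ⬝ᵥ Matrix.mulVec T ψ = 0) ∧ (1 / (L : ℂ) ^ 4) • (Matrix.conjTranspose (Literature.MathematicalPhysics.QuantumLattice.pairField Literature.MathematicalPhysics.QuantumLattice.dWaveFormFactor L) * Literature.MathematicalPhysics.QuantumLattice.pairField Literature.MathematicalPhysics.QuantumLattice.dWaveFormFactor L) - ((a - C / (L : ℝ) : ℝ)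 : ℂ) • (1 : Matrix (Finset (Literature.MathematicalPhysics.QuantumLattice.Orb (Literature.MathematicalPhysics.QuantumLattice.FermionTorus 2 L))) (Finset (Literature.MathematicalPhysics.QuantumLattice.Orb (Literature.MathematicalPhysics.QuantumLattice.FermionTorus 2 L))) ℂ) = ∑ i : Fin n, Matrix.conjTranspose (O i) * O i + ∑ i : Fin m, Matrix.conjTranspose (Q i) * (Literature.MathematicalPhysics.QuantumLattice.hubbardTorus 2 L 1 U * Q i - Q i * Literature.MathematicalPhysics.QuantumLattice.hubbardTorus 2 L 1 U) + (Literature.MathematicalPhysics.QuantumLattice.hubbardTorus 2 L 1 U * R - R * Literature.MathematicalPhysics.QuantumLattice.hubbardTorus 2 L 1 U) + T) :=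
  fun hMeso hWIB hCC => hCC (functionFieldCertificate_uniformPairOrder_of_halves hMeso hWIB)

end Summit.HubbardSuperconductivity.HubbardSuperconductivity.Theorems
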